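import Mathlib
import Summits.Ventures.HodgeRepro2.T6N42HypFlath
import Summits.Ventures.HodgeRepro2.T6N42FlathMain
import Summits.Ventures.HodgeRepro2.T6N42FlathTransfer
import Summits.Ventures.HodgeRepro2.T6N42FlathToy
import Summits.Ventures.HodgeRepro2.T6N42Datum
import Summits.Ventures.HodgeRepro2.T6N42Toy

/-!
# T6N42FlathDatum — `hIS` FROM THE FLATH COMPONENTS: a finite-places datum whose local `π`'s are
read as the components of a factorizable `W` satisfies `FinitePlacesDatum.IrreducibleSmooth`
(owner t6-p5)

`ReadAs L π` (OBJECTS): the datum's local representation `π` (on the datum's own group `G'` and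
space `Vπ`) is the component `L` transported along a group isomorphism `φ : G' ≃* G` and a linear
equivalence `e : L.V ≃ₗ[ℂ] Vπ`; its LAWS are the separate `Prop`-structure `ReadAs.IsReading`
(`φ` continuous, `e` intertwining) — t6-p3's objects/laws form (STATUS l. 12531), so that the
host obligation is counted by name. `FlathReading D` (OBJECTS): a shape, a family of components,
and a reading of every split / non-split local `π` of `D` as one of them; its laws
`FlathReading.IsReading`: the components are irreducible and smooth (`LocalIrreducibleSmooth` —
e.g. the `components` of `T6N42FlathMain` under the two displays) and every reading is a reading.
THE BRIDGE: `FlathReading.irreducibleSmooth : D.IrreducibleSmooth` (under the laws) — the residual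
`hIS` of the N4.2 block, discharged for any host `d42` built this way (the host's `N42Rich` instance
takes it as its `irreducibleSmooth` field). `FlathReading.ofDisplays` builds the reading's objects
directly from the two displays and an admissible irreducible `W`, `isReading_ofDisplays` its laws.
Toy (§10.5(ii)(d)): the toy datum `N42Toy.toyFinitePlaces` read through the toy shape re-derives
its `IrreducibleSmooth`.

README §8(d): uses an L-value-free non-vanishing device: NO (TIER5 §N4.2, a pre-02:16Z line of
record, continued).

Filed in Tier-6 WAVE 1 as p438645 (proposed 2026-08-26T10:39:54Z, ACCEPTED, commit 8c5cfb17d1a1);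
this v2 differs from the filed bytes in this module docstring only (the staged-record wording
dropped; every declaration byte-identical to v1).
-/

namespace Summit.Ventures.HodgeRepro2.T6.N42Flath

open Summit.Ventures.HodgeRepro2
open Summit.Ventures.HodgeRepro2.T6.N42Defs
open Summit.Ventures.HodgeRepro2.T6.N42Datum

/-- The local representation `π` of a datum, READ AS the component `L`, OBJECTS: a group isomorphism
`φ` from the datum's group onto the component's, and a linear equivalence `e` from the component's
space onto the datum's. Its laws are `ReadAs.IsReading`. -/
structure ReadAs {G : Type} [Group G] [TopologicalSpace G] (L : LocalRep G)
    {G' : Type} [Group G'] [TopologicalSpace G'] {Vπ : Type} [AddCommGroup Vπ] [Module ℂ Vπ]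
    (π : Representation ℂ G' Vπ) where
  /-- the identification of the groups -/
  φ : G' ≃* G
  /-- the identification of the spaces -/
  e : L.V ≃ₗ[ℂ] Vπ

namespace ReadAs

variable {G : Type} [Group G] [TopologicalSpace G] {L : LocalRep G}
variable {G' : Type} [Group G'] [TopologicalSpace G'] {Vπ : Type} [AddCommGroup Vπ] [Module ℂ Vπ]
variable {π : Representation ℂ G' Vπ}

/-- The LAWS of a reading: `φ` is continuous and `e` intertwines: `e (L.ρ (φ g) w) = π g (e w)`. -/
structure IsReading (R : ReadAs L π) : Prop where
  /-- `φ` is continuous -/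
  φ_cont : Continuous R.φ
  /-- `e` intertwines: `e (L.ρ (φ g) w) = π g (e w)` -/
  e_int : ∀ g w, R.e (L.ρ (R.φ g) w) = π g (R.e w)

/-- Irreducibility passes from the component to the datum's `π` (under the laws). -/
theorem isIrreducible (R : ReadAs L π) (hR : R.IsReading) (h : L.ρ.IsIrreducible) :
    π.IsIrreducible :=
  IsIrreducible.of_equiv (ρ := compMulEquiv L.ρ R.φ) R.e (fun g w => hR.e_int g w)
    (IsIrreducible.comp_mulEquiv R.φ h)

/-- Smoothness passes from the component to the datum's `π` (under the laws). -/
theorem isSmooth (R : ReadAs L π) (hR : R.IsReading) (h : LevelPositivity.IsSmooth L.ρ) :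
    LevelPositivity.IsSmooth π :=
  IsSmooth.of_equiv (ρ := compMulEquiv L.ρ R.φ) R.e (fun g w => hR.e_int g w)
    (IsSmooth.comp_of_continuous R.φ.toMonoidHom hR.φ_cont h)

/-- Irreducible and smooth, together (under the laws). -/
theorem isIrreducible_isSmooth (R : ReadAs L π) (hR : R.IsReading)
    (h : L.ρ.IsIrreducible ∧ LevelPositivity.IsSmooth L.ρ) :
    π.IsIrreducible ∧ LevelPositivity.IsSmooth π :=
  ⟨R.isIrreducible hR h.1, R.isSmooth hR h.2⟩

/-- A representation read as itself. -/
def refl {G : Type} [Group G] [TopologicalSpace G] (L : LocalRep G) : ReadAs L L.ρ where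
  φ := MulEquiv.refl G
  e := LinearEquiv.refl ℂ L.V

/-- … and it is a reading. -/
theorem refl_isReading {G : Type} [Group G] [TopologicalSpace G] (L : LocalRep G) :
    (refl L).IsReading where
  φ_cont := continuous_id
  e_int := fun _ _ => rfl

end ReadAs

/-- A FLATH READING of a finite-places datum, OBJECTS: a family of components over a shape and a
reading of every local `π` of the datum as one of them. Its laws are `FlathReading.IsReading`. -/
structure FlathReading (D : FinitePlacesDatum) where
  /-- the shape (`G(F_v)`, `G(𝔸_F^∞)`, `W`, …) -/
  S : FactorizationShape
  /-- the components `W_v` -/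
  Wv : ∀ v, LocalRep (S.G v)
  /-- the split places of the datum among the shape's places -/
  sp : D.SplitPlace → S.Place
  /-- the non-split places of the datum among the shape's places -/
  ns : D.NonsplitPlace → S.Place
  /-- `π₀,v` at a split place is the component at `sp v` -/
  readSplit : ∀ v, ReadAs (Wv (sp v)) (D.splitDatum v).pair.π
  /-- `π₀,v` at a non-split place is the component at `ns v` -/
  readNonsplit : ∀ v, ReadAs (Wv (ns v)) (D.towerDatum v).π

namespace FlathReading

variable {D : FinitePlacesDatum}

/-- The LAWS of a Flath reading: the components are irreducible and smooth (the conclusion of the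
two displays, `T6N42FlathMain`) and every reading is a reading. -/
structure IsReading (R : FlathReading D) : Prop where
  /-- the components are irreducible and smooth -/
  hWv : R.S.LocalIrreducibleSmooth R.Wv
  /-- the readings at the split places are readings -/
  readSplit : ∀ v, (R.readSplit v).IsReading
  /-- the readings at the non-split places are readings -/
  readNonsplit : ∀ v, (R.readNonsplit v).IsReading

/-- THE BRIDGE: a datum with a Flath reading (under its laws) satisfies `IrreducibleSmooth` — the
residual `hIS`. -/
theorem irreducibleSmooth (R : FlathReading D) (h : R.IsReading) : D.IrreducibleSmooth :=
  ⟨fun v => (R.readSplit v).isIrreducible_isSmooth (h.readSplit v) (h.hWv (R.sp v)),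
    fun v => (R.readNonsplit v).isIrreducible_isSmooth (h.readNonsplit v) (h.hWv (R.ns v))⟩

/-- A Flath reading FROM THE DISPLAYS (objects): the components are `T6N42FlathMain.components` of
an admissible irreducible `W` under `Hyp.GetzHahn2024_Thm5_7_1` and `Hyp.GetzHahn2024_Sec5_7_Note`.
-/
noncomputable def ofDisplays (S : FactorizationShape) (h₁ : Hyp.GetzHahn2024_Thm5_7_1 S)
    (h₂ : Hyp.GetzHahn2024_Sec5_7_Note S) (hW : S.AdmissibleIrreducible)
    (sp : D.SplitPlace → S.Place) (ns : D.NonsplitPlace → S.Place)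
    (readSplit : ∀ v, ReadAs (S.components h₁ h₂ hW (sp v)) (D.splitDatum v).pair.π)
    (readNonsplit : ∀ v, ReadAs (S.components h₁ h₂ hW (ns v)) (D.towerDatum v).π) :
    FlathReading D where
  S := S
  Wv := S.components h₁ h₂ hW
  sp := sp
  ns := ns
  readSplit := readSplit
  readNonsplit := readNonsplit

/-- … and its laws: the components' irreducibility and smoothness come from the displays
(`components_irreducibleSmooth`); the readings' laws are supplied. -/
theorem isReading_ofDisplays (S : FactorizationShape) (h₁ : Hyp.GetzHahn2024_Thm5_7_1 S)
    (h₂ : Hyp.GetzHahn2024_Sec5_7_Note S) (hW : S.AdmissibleIrreducible)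
    (sp : D.SplitPlace → S.Place) (ns : D.NonsplitPlace → S.Place)
    (readSplit : ∀ v, ReadAs (S.components h₁ h₂ hW (sp v)) (D.splitDatum v).pair.π)
    (readNonsplit : ∀ v, ReadAs (S.components h₁ h₂ hW (ns v)) (D.towerDatum v).π)
    (hsp : ∀ v, (readSplit v).IsReading) (hns : ∀ v, (readNonsplit v).IsReading) :
    (ofDisplays S h₁ h₂ hW sp ns readSplit readNonsplit).IsReading where
  hWv := S.components_irreducibleSmooth h₁ h₂ hW
  readSplit := hsp
  readNonsplit := hns

/-- `hIS` from the displays, in one line. -/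
theorem irreducibleSmooth_ofDisplays (S : FactorizationShape) (h₁ : Hyp.GetzHahn2024_Thm5_7_1 S)
    (h₂ : Hyp.GetzHahn2024_Sec5_7_Note S) (hW : S.AdmissibleIrreducible)
    (sp : D.SplitPlace → S.Place) (ns : D.NonsplitPlace → S.Place)
    (readSplit : ∀ v, ReadAs (S.components h₁ h₂ hW (sp v)) (D.splitDatum v).pair.π)
    (readNonsplit : ∀ v, ReadAs (S.components h₁ h₂ hW (ns v)) (D.towerDatum v).π)
    (hsp : ∀ v, (readSplit v).IsReading) (hns : ∀ v, (readNonsplit v).IsReading) :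
    D.IrreducibleSmooth :=
  (ofDisplays S h₁ h₂ hW sp ns readSplit readNonsplit).irreducibleSmooth
    (isReading_ofDisplays S h₁ h₂ hW sp ns readSplit readNonsplit hsp hns)

end FlathReading

/-! ### Toy (§10.5(ii)(d)): the toy datum read through the toy shape -/

open Summit.Ventures.HodgeRepro2.T6.N42Toy

/-- The toy datum's local `π`'s (the trivial representation of the trivial group on `ℂ`) read as the
trivial component. -/
def toyReading : FlathReading toyFinitePlaces where
  S := toyShape
  Wv := fun _ => trivialLocalRep
  sp := fun _ => ()
  ns := fun _ => ()
  readSplit := fun _ => ReadAs.refl trivialLocalRep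
  readNonsplit := fun _ => ReadAs.refl trivialLocalRep

/-- … and it satisfies the laws. -/
theorem toyReading_isReading : toyReading.IsReading where
  hWv := fun _ => ⟨trivial_irreducible, trivial_smooth⟩
  readSplit := fun _ => ReadAs.refl_isReading trivialLocalRep
  readNonsplit := fun _ => ReadAs.refl_isReading trivialLocalRep

/-- `IrreducibleSmooth` of the toy datum, re-derived through the Flath bridge. -/
theorem toyFinitePlaces_irreducibleSmooth_flath : toyFinitePlaces.IrreducibleSmooth :=
  toyReading.irreducibleSmooth toyReading_isReading

end Summit.Ventures.HodgeRepro2.T6.N42Flath
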